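import Literature.AlgebraicGeometry.Resolution.RationalResolutionH0InclusionExclusion
import Literature.AlgebraicGeometry.Morphisms.FinitelySupportedSections
import HarnessLib

/-!
# `h⁰` of a zero-dimensional closed subscheme is the sum of the local colengths
# (Lipman 1969, §10 (p. 212), §13 (p. 223): `h⁰(𝒪_{E∩F}) = Σ_w ℓ_S(𝒪_{X,w}/(𝓘_E + 𝓘_F)_w)`)

Topic: `Literature/AlgebraicGeometry/Resolution`.  PROVED, fact-free, definition-free.  For an `S`-scheme
`π : X → Spec S` and an ideal sheaf `𝓙` whose support is contained in a FINITE set `Z` of CLOSED points (a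
zero-dimensional closed subscheme `V(𝓙)`), the `h⁰`-length of `Resolution/Lipman1969RationalContraction`
(`h0 π 𝓙 = length_S Γ(V(𝓙), 𝒪)`) is the sum over `p ∈ Z` of the `S`-lengths of the local colengths
`Γ(U_p, 𝒪_X)/𝓙(U_p)` on any affine opens `U_p ∋ p` meeting `Z` only in `p`:

  `h0 π 𝓙 = Σ_{p ∈ Z} ℓ_S (Γ(U_p, 𝒪_X) ⧸ 𝓙(U_p))`.

This is the reading "`h⁰`, `h¹` are lengths over `A`" of J. Lipman, *Rational singularities …*, Publ. Math. IHÉS 36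
(1969), §10 (p. 212) for a ZERO-dimensional `C`, as used in §13 (proof of Prop. (13.1) d), p. 223): with
`Resolution/RationalResolutionH0InclusionExclusion` (`h⁰(𝒪/(𝓐∩𝓑)) + h⁰(𝒪/(𝓐+𝓑)) = h⁰(𝒪/𝓐) + h⁰(𝒪/𝓑)`) and
`Resolution/PrimeDivisorIdealsIntersection` (`𝓘_E ∩ 𝓘_F = 𝓘_E𝓘_F`) it turns Lipman's `χ(E) + χ(F) − χ(E+F)` for two
distinct exceptional curves into the sum of the local colengths `ℓ_S(Γ(U_w, 𝒪)/(𝓘_E + 𝓘_F)(U_w))` at the points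
`w ∈ E ∩ F` — the remaining step to Prop. (13.1) d) in the tree's `h⁰`-form (`Lipman1969_13_1_d_rat`, `η ≠ η′`)
being the local identity `ℓ_S(𝒪_{X,w}/(t, t′)) = [κ(w) : κ(𝔪)] · ord_{𝒪_{X,w}/(t)}(t̄′)` (Fulton, Ex. A.1.1 /
Lemma A.1.3; tree `ExceptionalCurveIntersectionSymmetry.ordAt_pullbackRep_primeDivisor_eq`).

* `ideal_eq_top_of_disjoint_support'` — `𝓙(V) = Γ(V, 𝒪)` on an affine `V` missing `supp 𝓙`;
* `idealQuot_sections_eq_zero_of_disjoint` — `𝒪_X/𝓙𝒪_X` has no non-zero sections off `supp 𝓙`;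
* `length_MSections_idealQuot_eq_length_quotient` — on an affine `U`, `ℓ_S Γ(U, 𝒪_X/𝓙𝒪_X) = ℓ_S (Γ(U, 𝒪_X)/𝓙(U))`
  (`Γ(U, 𝒪/𝓙) = Γ(U, 𝒪)/𝓙(U)`, Görtz–Wedhorn I Prop. 7.14);
* (private) `exists_isAffineOpen_inter_eq_singleton` — affine opens `U_p ∋ p` meeting a finite set of closed points
  only in `p`;
* **`h0_eq_sum_length_quotient_of_support_subset`** — the displayed formula (via
  `Morphisms/FinitelySupportedSections.MSections.length_top_eq_sum_of_finite_support`).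

## References
* J. Lipman, Publ. Math. IHÉS 36 (1969), §10 (p. 212), §13 (p. 223). [Lipman1969]
* W. Fulton, *Intersection Theory* (2nd ed. 1998), App. A.1 (Lemmas A.1.1–A.1.3). [Fulton1998]
* U. Görtz, T. Wedhorn, *Algebraic Geometry I* (2nd ed. 2020), Prop. 7.14. [GortzWedhorn2020]
* R. Hartshorne, *Algebraic Geometry* (1977), II Ex. 1.17. [Hartshorne1977]
-/

noncomputable section

-- `TopCat.Presheaf`/`Scheme.Modules` are not reducible (as in Mathlib's `AlgebraicGeometry/Modules`).
set_option backward.isDefEq.respectTransparency false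

open CategoryTheory CategoryTheory.Limits AlgebraicGeometry TopologicalSpace Opposite IsLocalRing
open Literature.AlgebraicGeometry.Morphisms Literature.AlgebraicGeometry.Modules

universe u

namespace Literature.AlgebraicGeometry.Resolution

variable {S : Type u} [CommRing S] {X : Scheme.{u}} (π : X ⟶ Spec (.of S))

/-! ## `𝒪_X/𝓙` is supported on `supp 𝓙` -/

/-- On an affine open `V` disjoint from `supp 𝓙`, `𝓙(V)` is the unit ideal. [cite: GortzWedhorn2020, Prop. 7.14] -/
theorem ideal_eq_top_of_disjoint_support' (𝓙 : X.IdealSheafData) {V : X.Opens} (hV : IsAffineOpen V)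
    (hW : Disjoint (V : Set X) (𝓙.support : Set X)) : 𝓙.ideal ⟨V, hV⟩ = ⊤ := by
  have h1 : X.zeroLocus (U := V) (𝓙.ideal ⟨V, hV⟩ : Set Γ(X, V)) ∩ V = ∅ := by
    rw [← Scheme.IdealSheafData.coe_support_inter 𝓙 ⟨V, hV⟩]
    exact Set.disjoint_iff_inter_eq_empty.mp hW.symm
  have h2 := hV.fromSpec_image_zeroLocus (𝓙.ideal ⟨V, hV⟩ : Set Γ(X, V))
  rw [h1, Set.image_eq_empty] at h2
  exact PrimeSpectrum.zeroLocus_empty_iff_eq_top.mp h2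

/-- **`𝒪_X/𝓙𝒪_X` has no non-zero sections over an open disjoint from `supp 𝓙`** (locally on affine `V`:
`Γ(V, 𝒪/𝓙) = Γ(V, 𝒪)/𝓙(V) = 0`). [cite: Hartshorne1977, II Ex. 1.17] -/
theorem idealQuot_sections_eq_zero_of_disjoint (𝓙 : X.IdealSheafData) (W : X.Opens)
    (hW : Disjoint (W : Set X) (𝓙.support : Set X))
    (s : MSections π (idealQuot (unitModule X) 𝓙) W) : s = 0 := by
  refine section_eq_zero_of_locally _ s fun x hx => ?_
  obtain ⟨V, hV, hxV, hVW⟩ := Opens.isBasis_iff_nbhd.mp X.isBasis_affineOpens hx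
  refine ⟨V, hVW, hxV, ?_⟩
  have hVd : Disjoint (V : Set X) (𝓙.support : Set X) := Set.disjoint_of_subset_left hVW hW
  obtain ⟨c, hc⟩ := idealQuotπ_unit_app_surjective 𝓙 hV
    ((idealQuot (unitModule X) 𝓙).presheaf.map (homOfLE hVW).op s)
  rw [← hc, idealQuotπ_unit_app_eq_zero_iff 𝓙 hV, ideal_eq_top_of_disjoint_support' 𝓙 hV hVd]
  exact Submodule.mem_top

/-! ## `Γ(U, 𝒪_X/𝓙𝒪_X) = Γ(U, 𝒪_X)/𝓙(U)` on an affine `U`, as `S`-lengths -/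

/-- **`ℓ_S Γ(U, 𝒪_X/𝓙𝒪_X) = ℓ_S (Γ(U, 𝒪_X) ⧸ 𝓙(U))` on an affine open `U`** (`Γ(U, 𝒪) → Γ(U, 𝒪/𝓙)` is onto with
kernel `𝓙(U)`). [cite: GortzWedhorn2020, Prop. 7.14] -/
theorem length_MSections_idealQuot_eq_length_quotient (𝓙 : X.IdealSheafData) {U : X.Opens}
    (hU : IsAffineOpen U) :
    Module.length S (MSections π (idealQuot (unitModule X) 𝓙) U) =
      Module.length S (Sections π U ⧸ (𝓙.ideal ⟨U, hU⟩).comap (Sections.equiv π U).toRingHom) := by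
  set J : Ideal (Sections π U) := (𝓙.ideal ⟨U, hU⟩).comap (Sections.equiv π U).toRingHom with hJ
  set φ : MSections π (unitModule X) U →ₗ[S] MSections π (idealQuot (unitModule X) 𝓙) U :=
    MSections.app π (idealQuotπ (unitModule X) 𝓙) U with hφ
  have hsurj : Function.Surjective φ := idealQuotπ_unit_app_surjective 𝓙 hU
  -- `Γ(U, 𝒪_X)` as sections of the unit module and as the `S`-algebra `Sections π U`: the identity
  let e0 : MSections π (unitModule X) U ≃ₗ[S] Sections π U :=
    { toFun := fun t => t, invFun := fun t => t, map_add' := fun _ _ => rfl, map_smul' := fun _ _ => rfl,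
      left_inv := fun _ => rfl, right_inv := fun _ => rfl }
  have hker : (LinearMap.ker φ).map (e0 : MSections π (unitModule X) U →ₗ[S] Sections π U) =
      J.restrictScalars S := by
    ext t
    rw [Submodule.mem_map_equiv, LinearMap.mem_ker, hφ, MSections.app_apply, Submodule.restrictScalars_mem,
      hJ, Ideal.mem_comap]
    exact idealQuotπ_unit_app_eq_zero_iff 𝓙 hU _
  rw [← (φ.quotKerEquivOfSurjective hsurj).length_eq,
    (Submodule.Quotient.equiv (LinearMap.ker φ) (J.restrictScalars S) e0 hker).length_eq]
  exact (Submodule.Quotient.restrictScalarsEquiv S J).length_eq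

/-! ## Affine opens isolating a point of a finite set of closed points -/

/-- For a finite set `Z` of closed points and `p ∈ Z` there is an affine open `U ∋ p` with `U ∩ Z = {p}`. [folklore] -/
private theorem exists_isAffineOpen_inter_eq_singleton {Z : Set X} (hZ : Z.Finite)
    (hZcl : ∀ p ∈ Z, IsClosed ({p} : Set X)) (p : X) :
    ∃ U : X.Opens, IsAffineOpen U ∧ p ∈ U ∧ ∀ q ∈ Z, q ∈ U → q = p := by
  -- the open complement of the closed set `Z ∖ {p}`
  have hcl : IsClosed (Z \ {p}) := by
    have hsub : Z \ {p} ⊆ Z := fun q hq => hq.1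
    have h := (hZ.subset hsub).isClosed_biUnion fun q (hq : q ∈ Z \ {p}) => hZcl q hq.1
    rwa [Set.biUnion_of_singleton] at h
  have hpW : p ∈ (⟨(Z \ {p})ᶜ, hcl.isOpen_compl⟩ : X.Opens) := fun h => h.2 rfl
  obtain ⟨U, hU, hpU, hUW⟩ := Opens.isBasis_iff_nbhd.mp X.isBasis_affineOpens hpW
  refine ⟨U, hU, hpU, fun q hq hqU => ?_⟩
  by_contra hqp
  exact hUW hqU ⟨hq, hqp⟩

/-! ## The formula -/

/-- **`h⁰(𝒪_X/𝓙) = Σ_{p ∈ Z} ℓ_S(Γ(U_p, 𝒪_X)/𝓙(U_p))` for an ideal sheaf supported in a finite set `Z` of closed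
points**, `U_p ∋ p` affine opens meeting `Z` only in `p`: `h0 π 𝓙 = ℓ_S Γ(X, 𝒪_X/𝓙𝒪_X)`
(`h0_eq_length_MSections_idealQuot`), `Γ(X, 𝒪_X/𝓙𝒪_X) = ⊕_p Γ(U_p, 𝒪_X/𝓙𝒪_X)` (finite support,
`MSections.length_top_eq_sum_of_finite_support`) and `Γ(U_p, 𝒪/𝓙) = Γ(U_p, 𝒪)/𝓙(U_p)`. This is Lipman's "length of
`H⁰` over `A`" (§10, p. 212) for the zero-dimensional `C = V(𝓙)`, e.g. `C = E ∩ F = V(𝓘_E + 𝓘_F)` in the proof of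
Prop. (13.1) d) (p. 223). [cite: Lipman1969, Section 10 (p. 212) and Section 13 (p. 223)] [cite: Hartshorne1977, II Ex. 1.17] -/
theorem h0_eq_sum_length_quotient_of_support_subset (𝓙 : X.IdealSheafData) {Z : Set X} (hZ : Z.Finite)
    (hZcl : ∀ p ∈ Z, IsClosed ({p} : Set X)) (hsupp : (𝓙.support : Set X) ⊆ Z) (U : X → X.Opens)
    (hUaff : ∀ p ∈ Z, IsAffineOpen (U p)) (hU : ∀ p ∈ Z, p ∈ U p) (hU' : ∀ p ∈ Z, ∀ q ∈ Z, q ∈ U p → q = p) :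
    haveI := hZ.fintype
    h0 π 𝓙 = ∑ p : Z, Module.length S (Sections π (U p.1) ⧸
      (𝓙.ideal ⟨U p.1, hUaff p.1 p.2⟩).comap (Sections.equiv π (U p.1)).toRingHom) := by
  haveI := hZ.fintype
  rw [h0_eq_length_MSections_idealQuot,
    MSections.length_top_eq_sum_of_finite_support π (idealQuot (unitModule X) 𝓙) hZcl
      (fun W hW s => idealQuot_sections_eq_zero_of_disjoint π 𝓙 W (hW.mono_right hsupp) s) U hU hU' hZ]
  exact Finset.sum_congr rfl fun p _ =>
    length_MSections_idealQuot_eq_length_quotient π 𝓙 (hUaff p.1 p.2)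

/-- **Existence form**: for an ideal sheaf supported in a finite set `Z` of closed points there are affine opens
`U_p ∋ p` meeting `Z` only in `p`, and for any such choice `h0 π 𝓙 = Σ_p ℓ_S(Γ(U_p, 𝒪)/𝓙(U_p))`; in particular
`h0 π 𝓙` is such a sum for SOME choice. [cite: Lipman1969, Section 10 (p. 212)] -/
theorem exists_h0_eq_sum_length_quotient (𝓙 : X.IdealSheafData) {Z : Set X} (hZ : Z.Finite)
    (hZcl : ∀ p ∈ Z, IsClosed ({p} : Set X)) (hsupp : (𝓙.support : Set X) ⊆ Z) :
    ∃ (U : X → X.Opens) (hUaff : ∀ p ∈ Z, IsAffineOpen (U p)),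
      (∀ p ∈ Z, p ∈ U p) ∧ (∀ p ∈ Z, ∀ q ∈ Z, q ∈ U p → q = p) ∧
      haveI := hZ.fintype
      h0 π 𝓙 = ∑ p : Z, Module.length S (Sections π (U p.1) ⧸
        (𝓙.ideal ⟨U p.1, hUaff p.1 p.2⟩).comap (Sections.equiv π (U p.1)).toRingHom) := by
  choose U hUaff hU hU' using fun p : X => exists_isAffineOpen_inter_eq_singleton hZ hZcl p
  exact ⟨U, fun p _ => hUaff p, fun p _ => hU p, fun p _ q hq hq' => hU' p q hq hq',
    h0_eq_sum_length_quotient_of_support_subset π 𝓙 hZ hZcl hsupp U (fun p _ => hUaff p) (fun p _ => hU p)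
      fun p _ q hq hq' => hU' p q hq hq'⟩

end Literature.AlgebraicGeometry.Resolution

end
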